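import Summits.FinalStateConjecture.FinalStateConjecture.Theorems.ClusterCompletenessAdiabaticMultiKerrILEDZeroSpinLateEnergyBound
import Summits.FinalStateConjecture.FinalStateConjecture.Theorems.ClusterCompletenessAdiabaticMultiKerrILEDFiniteTimeEnergy
import HarnessLib

/-!
# Crux `AdiabaticMultiKerrILED`, line `Sketch`: uniform boundedness of the exterior lab energy for
# ONE boosted tails-cut zone of ZERO SPIN, all times `t ≥ 0` (stub `energyBound_zeroSpin_single`)

Crux item `stmt-FinalStateConjecture-14310`
(`Summit.FinalStateConjecture.FinalStateConjecture.Theses.ClusterCompleteness.AdiabaticMultiKerrILED`),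
line `Sketch`, lead c7 wave 3, stub `energyBound_zeroSpin_single`: for one zero-spin tails-cut Kerr
zone boosted to lab speed `≤ v₀`, `E[ψ](t) ≤ C · E[ψ](0)` for ALL `t ≥ 0` and all smooth solutions
`ψ` of the patched divergence-form wave equation on `{x⁰ ≥ 0}` outside the horizon.

Composition of the late-time bound `lateEnergyBound_zeroSpin_single` (`t ≥ t₁`, module
`…ZeroSpinLateEnergyBound`) with the classical finite-time growth bound `stub_finiteTimeEnergy`
(`E(t) ≤ K e^{Kt} E(0)`, `t ≥ 0`; its spin and separation hypotheses are trivial at `N = 1`,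
`a = 0`): `C := max C_late (K e^{K max(t₁,0)})`, the same `[0, ∞]` bookkeeping as
`energyBound_of_finiteTime_late` of the split glue. [folklore]
-/

noncomputable section

-- the doubled `FinalStateConjecture.FinalStateConjecture` path component trips dupNamespace
set_option linter.dupNamespace false

open scoped ContDiff Topology BigOperators ENNReal InnerProductSpace
open Filter Set MeasureTheory Literature.Geometry.Lorentzian
open Summit.FinalStateConjecture.FinalStateConjecture.Cruxes.AdiabaticMultiKerrILED.Sketch

namespace Summit.FinalStateConjecture.FinalStateConjecture.Theorems

/-- **Uniform boundedness of the exterior lab energy, one boosted tails-cut zone of zero spin, all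
`t ≥ 0`** (stub `energyBound_zeroSpin_single` of line `Sketch`): there is `v₀ > 0` such that for
every single zero-spin tails-cut Kerr zone boosted to lab speed `≤ v₀ u⁰` there is `C` with
`E[ψ](t) ≤ C · E[ψ](0)` for all `t ≥ 0` and all smooth solutions `ψ` of the patched divergence-form
wave equation on `{x⁰ ≥ 0}` outside the horizon: for `t ≥ max(t₁, 0)` the late-time bound
`lateEnergyBound_zeroSpin_single` (Dafermos–Rodnianski arXiv:0811.0354, §3.3.4), for
`0 ≤ t ≤ max(t₁, 0)` the finite-time growth bound `stub_finiteTimeEnergy` and monotonicity of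
`K e^{Kt}`; `C := max C_late (K e^{K max(t₁, 0)})`. [folklore] -/
theorem energyBound_zeroSpin_single : ∃ v₀ : ℝ, 0 < v₀ ∧ ∀ (M : Fin 1 → ℝ) (Λ : Fin 1 → lorentzGroup) (p : Fin 1 → E3) (u : Fin 1 → E4) (q : Fin 1 → E4 → E4), (∀ i, u i = (Λ i : E4 ≃L[ℝ] E4) (E4.basisVector 0)) → (∀ i x, q i x = poincareInv (Λ i) (E4.ofTimeSpace 0 (p i)) x) → (∀ i, 0 < M i) → (∀ i, 0 < u i 0 ∧ ‖E4.spatial (u i)‖ ≤ v₀ * u i 0) → ∀ (G : E4 → Fin 4 → Fin 4 → ℝ), (∀ x μ ν, G x μ ν = Minkowski.bilin (E4.basisVector μ) (E4.basisVector ν) - ∑ i, Real.smoothTransition (2 - Kerr.radius 0 (q i x) / (8 * M i)) * (2 * Kerr.scalarH (M i) 0 (q i x)) * ((Λ i : E4 ≃L[ℝ] E4) (Kerr.nullVector 0 (q i x))) μ * ((Λ i : E4 ≃L[ℝ] E4) (Kerr.nullVector 0 (q i x))) ν) → ∀ (E : (E4 → ℝ) → ℝ → ENNReal), (∀ φ t,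 E φ t = ∫⁻ y in {y : E3 | ∀ i, Kerr.rPlus (M i) 0 < Kerr.radius 0 (q i (E4.ofTimeSpace t y))}, ENNReal.ofReal (∑ μ : Fin 4, (fderiv ℝ φ (E4.ofTimeSpace t y) (E4.basisVector μ)) ^ 2)) → ∃ C : NNReal, ∀ ψ : E4 → ℝ, ContDiff ℝ ∞ ψ → (∀ x : E4, 0 ≤ x 0 → (∀ i, Kerr.rPlus (M i) 0 < Kerr.radius 0 (q i x)) → ∑ μ : Fin 4, fderiv ℝ (fun y ↦ ∑ ν : Fin 4, G y μ ν * fderiv ℝ ψ y (E4.basisVector ν)) x (E4.basisVector μ) = 0) → ∀ t : ℝ, 0 ≤ t → E ψ t ≤ (C : ENNReal) * E ψ 0 := by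
  obtain ⟨v₀, hv₀, HLT⟩ := lateEnergyBound_zeroSpin_single
  refine ⟨min v₀ 2⁻¹, lt_min hv₀ (by norm_num), ?_⟩
  intro M Λ p u q hu hq hM hv G hG E hE
  -- at `N = 1`, `a = 0` the spin and separation hypotheses of the finite-time bound are trivial
  have ha₂ : ∀ i : Fin 1, |(0 : ℝ)| ≤ 2⁻¹ * M i := fun i ↦ by
    rw [abs_zero]; exact mul_nonneg (by norm_num) (hM i).le
  have hv₁ : ∀ i, 0 < u i 0 ∧ ‖E4.spatial (u i)‖ ≤ v₀ * u i 0 := fun i ↦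
    ⟨(hv i).1, (hv i).2.trans (mul_le_mul_of_nonneg_right (min_le_left _ _) (hv i).1.le)⟩
  have hv₂ : ∀ i, 0 < u i 0 ∧ ‖E4.spatial (u i)‖ ≤ 2⁻¹ * u i 0 := fun i ↦
    ⟨(hv i).1, (hv i).2.trans (mul_le_mul_of_nonneg_right (min_le_right _ _) (hv i).1.le)⟩
  have hsep₂ : ∀ i j : Fin 1, i ≠ j → 40 * (M i + M j) ≤ dist (p i) (p j) ∧
      0 < ⟪p i - p j, (u i 0)⁻¹ • E4.spatial (u i) - (u j 0)⁻¹ • E4.spatial (u j)⟫_ℝ :=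
    fun i j hij ↦ absurd (Subsingleton.elim i j) hij
  obtain ⟨t₁, C, HC⟩ := HLT M Λ p u q hu hq hM hv₁ G hG E hE
  obtain ⟨K, hK0, HK⟩ :=
    stub_finiteTimeEnergy 1 M (fun _ ↦ 0) Λ p u q hu hq hM ha₂ hv₂ hsep₂ G hG E hE
  set K₁ : NNReal := Real.toNNReal (K * Real.exp (K * max t₁ 0)) with hK₁
  refine ⟨max C K₁, fun ψ hψ hsol t ht ↦ ?_⟩
  rcases le_or_gt t₁ t with h | h
  · refine (HC ψ hψ hsol t h).trans ?_
    gcongr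
    exact_mod_cast le_max_left _ _
  · refine (HK ψ hψ hsol t ht).trans ?_
    gcongr
    have hmono : K * Real.exp (K * t) ≤ K * Real.exp (K * max t₁ 0) := by
      apply mul_le_mul_of_nonneg_left _ hK0
      exact Real.exp_le_exp.mpr (mul_le_mul_of_nonneg_left (h.le.trans (le_max_left _ _)) hK0)
    calc ENNReal.ofReal (K * Real.exp (K * t))
        ≤ ENNReal.ofReal (K * Real.exp (K * max t₁ 0)) := ENNReal.ofReal_le_ofReal hmono
      _ = (K₁ : ENNReal) := by rw [hK₁, ENNReal.ofReal]
      _ ≤ ((max C K₁ : NNReal) : ENNReal) := by exact_mod_cast le_max_right _ _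

end Summit.FinalStateConjecture.FinalStateConjecture.Theorems

end
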